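import Mathlib.RingTheory.Length
import Mathlib.Algebra.Module.Torsion.Basic
import Mathlib.RingTheory.Ideal.Maximal
import Mathlib.LinearAlgebra.Span.Basic
import Mathlib.RingTheory.LocalRing.MaximalIdeal.Basic
import Mathlib.LinearAlgebra.Isomorphisms
import Mathlib.LinearAlgebra.Dimension.Finite
import Mathlib.FieldTheory.Finiteness
import Mathlib.RingTheory.Ideal.Quotient.Basic
import HarnessLib

/-!
# Lengths of the eigenparts of a maximal isotropic `τ`-stable subspace (the module-theoretic core of the
# (GD-line) count in Howard 2004, Lemma 1.5.3), and the cardinality/length dictionary for modules killed by `𝔪`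

Topic `Algebra/Module` (pure algebra; Mathlib-only imports). THEOREMS ONLY: no definition, no named fact, no instance,
no notation, no `sorry`. Cell `pub/bsd-print-x9`, print leaf G87 `Howard2004.thm161_dvrKolyvaginBound`; seat
`bsd-line-x10b-p1-w5` g8, core of (GD-COUNT) = the letter `hGD : length_R loc_q(S ⊓ E) = 1` of
`Howard2004/EigenSelmerParityProofs` (consumer: `Howard2004/EigenSelmerLineCountProofs`).

SOURCE. B. Howard, *The Heegner point Kolyvagin system*, Compositio Math. **140** (2004) = arXiv:1202.6340, Lemma 1.5.3,
proof (p. 10 L10–19): «By global duality the images of the rightmost arrows are exact orthogonal complements under the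
`G_ℚ`-invariant local Tate pairing. Furthermore the action of complex conjugation splits `H¹_f(K_ℓ, T̄)` and
`H¹_s(K_ℓ, T̄)` each into one-dimensional eigenspaces …»; Lemma 1.5.6 (p. 10 L93–97): «`len(A) = … = 2k·ν(n)`».
At the residual level: `A = loc_ℓ H¹_{F^ℓ(n)}(K, T̄)` is a `τ`-stable plane (`#A·#A = #H¹(K_ℓ, T̄)`), isotropic, inside
`H¹(K_ℓ, T̄) = H⁺ ⊕ H⁻` with `H^±` non-degenerate planes; hence `A^± := A ∩ H^±` are LINES.

WHAT IS PROVED (any ring `R`, `R`-module `V`):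
* **`length_inf_eq_one_of_split`**: submodules `Hp`, `Hm`, `A` of length `2` with `A = (A ⊓ Hp) + (A ⊓ Hm)` elementwise
  and `¬ Hp ≤ A`, `¬ Hm ≤ A` ⇒ `length (A ⊓ Hp) = 1 = length (A ⊓ Hm)`;
* `length_span_singleton_eq_one` (`R` local, `𝔪 v = 0`, `v ≠ 0` ⇒ `length (R ∙ v) = 1`: the eigenLINES have length one);
* `length_sup_eq_add_of_disjoint` (`length (P ⊔ Q) = length P + length Q` for disjoint submodules);
* **`natCard_eq_pow_length`** (`M` finite killed by a maximal `𝔪` with `R/𝔪` finite ⇒ `length_R M < ⊤` and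
  `#M = #(R/𝔪) ^ length_R M`) — converts the cardinality count of `RelaxedSelmerLagrangianCountProofs` into lengths.

No summit statement is proved; BSD is not proved by any of this.
References: [Howard2004HeegnerKolyvagin] Lemma 1.5.3, Lemma 1.5.6.
-/

set_option autoImplicit false

namespace Literature.Algebra.Module

section LengthCount

variable {R : Type*} [Ring R] {V : Type*} [AddCommGroup V] [Module R V]

/-- A proper submodule of a module of length `2` has length `≤ 1` (additivity of length on
`0 → N → M → M/N → 0`, the quotient being non-trivial). [folklore] -/
private theorem length_le_one_of_ne_top_of_length_eq_two {M : Submodule R V} (hM : Module.length R M = 2)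
    {N : Submodule R V} (hNM : N ≤ M) (hne : N ≠ M) : Module.length R N ≤ 1 := by
  -- `N` as a submodule of `M`
  let N' : Submodule R M := N.comap M.subtype
  have hN' : Module.length R N' = Module.length R N :=
    (Submodule.comapSubtypeEquivOfLe hNM).length_eq
  have hadd := Module.length_eq_add_of_exact N'.subtype N'.mkQ (Submodule.subtype_injective _)
    (Submodule.mkQ_surjective _) (LinearMap.exact_subtype_mkQ N')
  rw [hM, hN'] at hadd
  -- the quotient is non-trivial
  have hq : N' ≠ ⊤ := by
    intro h
    apply hne
    refine le_antisymm hNM fun x hx => ?_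
    have : (⟨x, hx⟩ : M) ∈ N' := by rw [h]; trivial
    exact this
  have hpos : 0 < Module.length R (M ⧸ N') := by
    rw [Module.length_pos_iff, Submodule.Quotient.nontrivial_iff]
    exact hq
  -- `2 = len N + len Q`, `len Q ≥ 1` ⇒ `len N ≤ 1`
  by_contra hlt
  push Not at hlt
  have h1 : (1 : ℕ∞) ≤ Module.length R (M ⧸ N') := Order.one_le_iff_pos.mpr hpos
  have h2 : (2 : ℕ∞) ≤ Module.length R N := by
    have := Order.add_one_le_of_lt hlt
    simpa [one_add_one_eq_two] using this
  have : (2 : ℕ∞) + 1 ≤ 2 := by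
    calc (2 : ℕ∞) + 1 ≤ Module.length R N + Module.length R (M ⧸ N') := add_le_add h2 h1
      _ = 2 := hadd.symm
  exact absurd this (by decide)

/-- **The (GD-line) count.** In an `R`-module, let `Hp`, `Hm` be submodules («the `τ`-eigenparts of `H¹(K_ℓ, T̄)`»)
of length `2` each, and `A` («the local image of `H¹_{F^ℓ(n)}(K, T̄)`») a submodule of length `2` which splits along
them (`A = (A ⊓ Hp) + (A ⊓ Hm)` elementwise) and contains neither (`¬ Hp ≤ A`, `¬ Hm ≤ A` — an isotropic `A` cannot
contain a non-degenerate eigenpart). Then `length (A ⊓ Hp) = 1` and `length (A ⊓ Hm) = 1`: «exact orthogonal complements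
under the `G_ℚ`-invariant local Tate pairing … one-dimensional eigenspaces».
[cite: Howard2004HeegnerKolyvagin, Lemma 1.5.3 proof (arXiv:1202.6340 p. 10 L10–19) with Lemma 1.5.6 (p. 10 L84–97: `len(A) = 2k·ν`)] -/
theorem length_inf_eq_one_of_split (Hp Hm A : Submodule R V) (hHp : Module.length R Hp = 2)
    (hHm : Module.length R Hm = 2) (hA : Module.length R A = 2)
    (hsplit : ∀ a ∈ A, ∃ ap ∈ A ⊓ Hp, ∃ am ∈ A ⊓ Hm, a = ap + am)
    (hp : ¬ Hp ≤ A) (hm : ¬ Hm ≤ A) :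
    Module.length R ↥(A ⊓ Hp) = 1 ∧ Module.length R ↥(A ⊓ Hm) = 1 := by
  have hle_p : Module.length R ↥(A ⊓ Hp) ≤ 1 :=
    length_le_one_of_ne_top_of_length_eq_two hHp inf_le_right fun h => hp (h ▸ inf_le_left)
  have hle_m : Module.length R ↥(A ⊓ Hm) ≤ 1 :=
    length_le_one_of_ne_top_of_length_eq_two hHm inf_le_right fun h => hm (h ▸ inf_le_left)
  -- `A` is a quotient of `(A ⊓ Hp) × (A ⊓ Hm)` (the sum map), so `2 ≤ len (A ⊓ Hp) + len (A ⊓ Hm)`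
  let f : ↥(A ⊓ Hp) × ↥(A ⊓ Hm) →ₗ[R] A :=
    (Submodule.inclusion (inf_le_left : A ⊓ Hp ≤ A)).coprod (Submodule.inclusion (inf_le_left : A ⊓ Hm ≤ A))
  have hf : Function.Surjective f := by
    rintro ⟨a, ha⟩
    obtain ⟨ap, hap, am, ham, rfl⟩ := hsplit a ha
    exact ⟨(⟨ap, hap⟩, ⟨am, ham⟩), by ext; rfl⟩
  have hge : (2 : ℕ∞) ≤ Module.length R ↥(A ⊓ Hp) + Module.length R ↥(A ⊓ Hm) := by
    rw [← hA, ← Module.length_prod]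
    exact Module.length_le_of_surjective f hf
  -- values in `{0, 1}` summing to at least `2`
  have key : ∀ a b : ℕ∞, a ≤ 1 → b ≤ 1 → 2 ≤ a + b → a = 1 ∧ b = 1 := by
    intro a b ha hb hab
    have ha' : a ≠ ⊤ := ne_top_of_le_ne_top (by decide) ha
    have hb' : b ≠ ⊤ := ne_top_of_le_ne_top (by decide) hb
    lift a to ℕ using ha'
    lift b to ℕ using hb'
    norm_cast at ha hb hab ⊢
    omega
  exact key _ _ hle_p hle_m hge

/-- **A cyclic module killed by a maximal ideal has length `1`**: if `v ≠ 0` and the maximal ideal `𝔪` of a local ring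
kills `v`, then `R ∙ v ≅ R/𝔪` is simple. (The eigenLINES `H¹_f(K_ℓ, T̄)^±`, `H¹_tr(K_ℓ, T̄)^±` have length one.)
[cite: Howard2004HeegnerKolyvagin, Lemma 1.5.3 proof (arXiv p. 10 L12–16: «one-dimensional eigenspaces»)] -/
theorem length_span_singleton_eq_one {R : Type*} [CommRing R] [IsLocalRing R] {V : Type*} [AddCommGroup V]
    [Module R V] {v : V} (hv : v ≠ 0) (hm : ∀ a ∈ IsLocalRing.maximalIdeal R, a • v = 0) :
    Module.length R ↥(R ∙ v) = 1 := by
  rw [Module.length_eq_one_iff, isSimpleModule_iff_quot_maximal]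
  refine ⟨IsLocalRing.maximalIdeal R, IsLocalRing.maximalIdeal.isMaximal R, ⟨?_⟩⟩
  -- `R ∙ v ≃ R ⧸ torsionOf v` and `torsionOf v = 𝔪`
  have htors : Ideal.torsionOf R V v = IsLocalRing.maximalIdeal R := by
    refine ((IsLocalRing.maximalIdeal.isMaximal R).eq_of_le ?_ fun a ha => ?_).symm
    · rw [Ne, Ideal.eq_top_iff_one, Ideal.mem_torsionOf_iff, one_smul]
      exact hv
    · exact (Ideal.mem_torsionOf_iff v a).mpr (hm a ha)
  exact (Ideal.quotTorsionOfEquivSpanSingleton R V v).symm.trans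
    (Submodule.quotEquivOfEq _ _ htors)

/-- **Length of a direct sum of two submodules**: for `Disjoint P Q`, `length (P ⊔ Q) = length P + length Q`
(the sum map `P × Q → P ⊔ Q` is an isomorphism). [folklore] [cite: Howard2004HeegnerKolyvagin, Lemma 1.5.3 proof (arXiv p. 10 L12–16: the eigenparts are sums of eigenlines)] -/
theorem length_sup_eq_add_of_disjoint (P Q : Submodule R V) (hPQ : Disjoint P Q) :
    Module.length R ↥(P ⊔ Q) = Module.length R P + Module.length R Q := by
  let f : P × Q →ₗ[R] ↥(P ⊔ Q) :=
    (Submodule.inclusion (le_sup_left : P ≤ P ⊔ Q)).coprod (Submodule.inclusion (le_sup_right : Q ≤ P ⊔ Q))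
  have hf : Function.Bijective f := by
    constructor
    · intro x y hxy
      obtain ⟨⟨a, ha⟩, ⟨b, hb⟩⟩ := x
      obtain ⟨⟨a', ha'⟩, ⟨b', hb'⟩⟩ := y
      have h : a + b = a' + b' := congrArg Subtype.val hxy
      -- `a - a' = b' - b ∈ P ⊓ Q = 0`
      have hmem : a - a' ∈ Q := by
        have : a - a' = b' - b := by rw [sub_eq_iff_eq_add, add_comm, ← add_sub_assoc, ← h]; abel
        rw [this]; exact Q.sub_mem hb' hb
      have h0 : a - a' = 0 := (Submodule.disjoint_def.mp hPQ) _ (P.sub_mem ha ha') hmem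
      have ha_eq : a = a' := sub_eq_zero.mp h0
      have hb_eq : b = b' := by
        rw [ha_eq] at h; exact add_left_cancel h
      subst ha_eq hb_eq
      rfl
    · rintro ⟨x, hx⟩
      obtain ⟨a, ha, b, hb, rfl⟩ := Submodule.mem_sup.mp hx
      exact ⟨(⟨a, ha⟩, ⟨b, hb⟩), rfl⟩
  rw [← (LinearEquiv.ofBijective f hf).length_eq, Module.length_prod]

/-- **Cardinality versus length for a module killed by a maximal ideal with finite residue field**: a finite
`R`-module `M` with `𝔪 M = 0` is a finite-dimensional `R/𝔪`-vector space, its `R`-length is that dimension, and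
`#M = #(R/𝔪) ^ length_R M`. (Turns the cardinality form «`#A · #A = #H¹(K_q, T̄)`» of Howard's «`len(A) = 2k·ν`»
into lengths at the residual level.) [folklore] [cite: Howard2004HeegnerKolyvagin, Lemma 1.5.6 (arXiv p. 10 L93–97: `len(A) = … = 2k·ν(n)`)] -/
theorem natCard_eq_pow_length {R : Type*} [CommRing R] (𝔪 : Ideal R) [𝔪.IsMaximal] [Finite (R ⧸ 𝔪)]
    {M : Type*} [AddCommGroup M] [Module R M] [Finite M] (hM : ∀ a ∈ 𝔪, ∀ x : M, a • x = 0) :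
    Module.length R M ≠ ⊤ ∧ Nat.card M = Nat.card (R ⧸ 𝔪) ^ (Module.length R M).toNat := by
  classical
  have htors : Module.IsTorsionBySet R M 𝔪 := fun x a => hM a a.2 x
  letI : Module (R ⧸ 𝔪) M := htors.module
  haveI : IsScalarTower R (R ⧸ 𝔪) M := htors.isScalarTower
  letI : Field (R ⧸ 𝔪) := Ideal.Quotient.field 𝔪
  haveI : Module.Finite (R ⧸ 𝔪) M := Module.Finite.of_finite
  have hlen : Module.length R M = Module.length (R ⧸ 𝔪) M :=
    Module.length_eq_of_surjective (S := R) (R := R ⧸ 𝔪) Ideal.Quotient.mk_surjective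
  rw [hlen, Module.length_eq_finrank]
  refine ⟨WithTop.natCast_ne_top _, ?_⟩
  rw [ENat.toNat_coe]
  exact Module.natCard_eq_pow_finrank

end LengthCount

end Literature.Algebra.Module
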